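import Literature.NumberTheory.ComplexMultiplication.CMTypeRankPartialConjugation
import Literature.NumberTheory.ComplexMultiplication.PartialConjugationOfRealIntersection
import Summits.HodgeConjecture.CorCM.IndependentCMFieldsHodge
import HarnessLib

/-!
# Products of CM abelian varieties whose Galois closures MEET IN TOTALLY REAL FIELDS: additive rank, stable
# nondegeneracy factor by factor, and the Hodge conjecture for every `∏_i A_i^{k_i}`

COR-CM (cell `pub-hodgecm2`, binder seat `b23` gen 28), count-neutral; NEW as stated, hence under `Summits/`.  The files
`Summits/HodgeConjecture/CorCM/IndependentCMFieldsHodge` and `…/LinearlyDisjointCMFieldsHodge` prove that for CM fields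
`K_i` on whose complex embeddings `Aut(ℂ)` acts SLOTWISE INDEPENDENTLY (e.g. with LINEARLY DISJOINT Galois closures) the
rank of a family of CM types is additive, the family is nondegenerate iff every member is, and every product
`⨁_{j<N} A_{π j}` of realisations of nondegenerate types has `Bᵐ ⊗ ℂ = Dᵐ ⊗ ℂ` and satisfies the Hodge conjecture.  The
literature file `Literature.NumberTheory.ComplexMultiplication.CMTypeRankPartialConjugation` (this seat) shows that the
whole mechanism needs much less than independence: a PARTIAL CONJUGATION at every slot — some `σ_i ∈ Aut(ℂ)` which is
complex conjugation on `Hom(K_i, ℂ)` and the identity on every `Hom(K_j, ℂ)`, `j ≠ i` (the element of Gordon's proof of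
the theorem of Imai–Murty, up to `σ ↦ ρσ`) — and `…PartialConjugationOfRealIntersection` shows that such a `σ_i` exists
iff complex conjugation fixes `L_i ∩ ∏_{j≠i} L_j` pointwise (`L_i = normalClosure ℚ K_i ℂ`), i.e. iff the Galois
closures MEET IN TOTALLY REAL FIELDS.  This file records the consequences BY NAME:

* `cmFamilyRank_add_card_eq_of_partialConj`, `…_of_conj_apply_eq` — `rank Hg(∏_i A_{Φ_i}) = Σ_i rank Hg(A_{Φ_i})`;
* `isNondegenerateFamily_iff_of_partialConj`, `…_of_conj_apply_eq` — the family `(Φ_i)` is nondegenerate iff every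
  `Φ_i` is;
* `hodgeClassSpan_prod_eq_divisorClassesSpan_of_conj_apply_eq`, `not_exists_exceptional_prod_of_conj_apply_eq`,
  **`hodgeConjectureFor_prod_of_partialConj`**, **`hodgeConjectureFor_prod_of_conj_apply_eq`** — for NONDEGENERATE types
  `Φ_i` of CM fields whose Galois closures meet in totally real fields, every product `⨁_{j<N} A_{π j}` (every
  `∏_i A_i^{k_i}`) of realisations has `B• = D•` and satisfies the Hodge conjecture, UNCONDITIONALLY (no named fact).

What is NEW relative to the linearly disjoint files: the fields may share any TOTALLY REAL subfield.  Two DISTINCT cyclic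
quartic CM fields with the same real quadratic subfield `ℚ(√d)` (e.g. `ℚ(ζ_5)` and the other cyclic quartic CM field over
`ℚ(√5)`), or `ℚ(ζ_7)` and `ℚ(ζ_7 + ζ_7⁻¹)(√−3)` (meeting in the real cubic field), or the CM fields `F·k_i` for a fixed
totally real Galois `F` and distinct imaginary quadratic `k_i` outside the compositum of the others, have
`L_i ∩ ∏_{j≠i} L_j ⊋ ℚ` — the Galois actions on embeddings are NOT independent, `LinearlyDisjointCMFieldsHodge` does not
apply, and a single-field slice (`CMSliceDegreeLeFour`, the cyclotomic slices) does not see the product — yet every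
`∏_i A_i^{k_i}` of realisations of primitive (= nondegenerate in degree `≤ 6`, Ribet; degree `2p`, Yanai) types satisfies the
Hodge conjecture.  Convenient sufficient conditions (from the literature file): every `L_i ∩ ∏_{j≠i} L_j` has ODD
degree (a Galois subfield of `ℂ` of odd degree is totally real) — `hodgeConjectureFor_prod_of_odd_finrank_inf`; all of them
lie in one real field `F` — `hodgeConjectureFor_prod_of_inf_le`; two slots with conjugation fixing `L_{i₀} ∩ L_{i₁}` —
`hodgeConjectureFor_prod_pair_of_conj_apply_eq`, `…_pair_of_odd_finrank`.

Everything is a short application; theorems only, no definition, no `sorry`.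

## References

* [Gordon1999HodgeAVSurvey] B. B. Gordon, *A survey of the Hodge conjecture for abelian varieties*, §3 Theorem (Imai,
  Murty) with proof ("there is some `σ ∈ 𝒢` that acts as `+1` on `X(K^×_{1,1})` and `−1` on the other components");
  7.5–7.7; 10.10.
* [Lang2002] S. Lang, *Algebra*, 3rd ed., VI §1 Thm. 1.14 (the Galois group of a compositum as a fibre product).
-/

noncomputable section

open CategoryTheory CategoryTheory.Limits NumberField IntermediateField

namespace Summit.HodgeConjecture.CorCM

open Literature.NumberTheory.ComplexMultiplication
open Literature.AlgebraicGeometry.Motives (AbelianVariety CMType)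
open Literature.AlgebraicGeometry.HodgeTheory
open Literature.AlgebraicGeometry.ComplexMultiplication (IsCMTypeRealisation)
open Literature.AlgebraicGeometry.VanGeemen1994 (hodgeClassSpan)
open Literature.AlgebraicGeometry.Pohlmann1968
open Literature.Barriers.HodgeConjecture (divisorClassesSpan)

section Rank

variable {I : Type} {K : I → Type} [∀ i, Field (K i)] [∀ i, NumberField (K i)] [∀ i, IsCMField (K i)] [Fintype I]
  [Nonempty I]

/-- **Additivity of the rank under partial conjugations**: if for every slot `i` some `σ_i ∈ Aut(ℂ)` is complex
conjugation on `Hom(K_i, ℂ)` and the identity on every `Hom(K_j, ℂ)`, `j ≠ i`, then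
`cmFamilyRank Φ + |I| = Σ_i cmTypeRank Φ_i + 1`, i.e. `rank Hg(∏_i A_{Φ_i}) = Σ_i rank Hg(A_{Φ_i})` — Gordon §3 Theorem (1)
"`Hg(A) = Hg(E_1) × ⋯ × Hg(E_r)`" for arbitrary CM fields, using only the element his proof uses.
[cite: Gordon1999HodgeAVSurvey, §3 Theorem (1)] -/
theorem cmFamilyRank_add_card_eq_of_partialConj
    (hconj : ∀ i : I, ∃ σ : ℂ ≃+* ℂ, (∀ s : K i →+* ℂ, σ • s = (starRingAut : ℂ ≃+* ℂ) • s) ∧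
      ∀ j, j ≠ i → ∀ s : K j →+* ℂ, σ • s = s)
    (Φ : ∀ i, CMType (K i)) :
    CMAlgebra.cmFamilyRank Φ + Fintype.card I = (∑ i, cmTypeRank (Φ i)) + 1 :=
  typeRank_sigmaType_add_card_eq_of_partialConj (G := ℂ ≃+* ℂ) (Φ := fun i => (Φ i).1)
    (fun i => isCMTypeWith_conj (Φ i)) hconj

/-- **Under partial conjugations a family of CM types is nondegenerate iff every member is** (`∏_i A_{Φ_i}` stably
nondegenerate ⟺ every `A_{Φ_i}` stably nondegenerate; Gordon §3 Theorem (2), 7.5 (3)).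
[cite: Gordon1999HodgeAVSurvey, §3 Theorem and 7.5] -/
theorem isNondegenerateFamily_iff_of_partialConj
    (hconj : ∀ i : I, ∃ σ : ℂ ≃+* ℂ, (∀ s : K i →+* ℂ, σ • s = (starRingAut : ℂ ≃+* ℂ) • s) ∧
      ∀ j, j ≠ i → ∀ s : K j →+* ℂ, σ • s = s)
    (Φ : ∀ i, CMType (K i)) : CMAlgebra.IsNondegenerateFamily Φ ↔ ∀ i, IsNondegenerate (Φ i) := by
  have key := typeRank_sigmaType_eq_iff_forall_of_partialConj (G := ℂ ≃+* ℂ) (Φ := fun i => (Φ i).1)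
    (fun i => isCMTypeWith_conj (Φ i)) hconj
  have hcard : Fintype.card ((i : I) × (K i →+* ℂ)) = ∑ i, Module.finrank ℚ (K i) := by
    rw [Fintype.card_sigma]
    exact Finset.sum_congr rfl fun i _ => Embeddings.card (K i) ℂ
  rw [hcard] at key
  simp only [Embeddings.card] at key
  exact key

/-- **Additivity of the rank for CM fields whose Galois closures meet in totally real fields**: if complex conjugation
fixes `L_i ∩ ∏_{j≠i} L_j` pointwise for every `i` (`L_i = normalClosure ℚ K_i ℂ`), then
`rank Hg(∏_i A_{Φ_i}) = Σ_i rank Hg(A_{Φ_i})` for ALL CM types `Φ_i`. [cite: Gordon1999HodgeAVSurvey, §3 Theorem (1)] -/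
theorem cmFamilyRank_add_card_eq_of_conj_apply_eq
    (hreal : ∀ (i : I) (x : ℂ), x ∈ normalClosure ℚ (K i) ℂ →
      x ∈ (⨆ j : {j : I // j ≠ i}, normalClosure ℚ (K j.1) ℂ) → starRingEnd ℂ x = x)
    (Φ : ∀ i, CMType (K i)) :
    CMAlgebra.cmFamilyRank Φ + Fintype.card I = (∑ i, cmTypeRank (Φ i)) + 1 :=
  cmFamilyRank_add_card_eq_of_partialConj (forall_exists_partialConj_of_conj_apply_eq hreal) Φ

/-- **For CM fields whose Galois closures meet in totally real fields a family of CM types is nondegenerate iff every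
member is.** [cite: Gordon1999HodgeAVSurvey, §3 Theorem and 7.5] -/
theorem isNondegenerateFamily_iff_of_conj_apply_eq
    (hreal : ∀ (i : I) (x : ℂ), x ∈ normalClosure ℚ (K i) ℂ →
      x ∈ (⨆ j : {j : I // j ≠ i}, normalClosure ℚ (K j.1) ℂ) → starRingEnd ℂ x = x)
    (Φ : ∀ i, CMType (K i)) : CMAlgebra.IsNondegenerateFamily Φ ↔ ∀ i, IsNondegenerate (Φ i) :=
  isNondegenerateFamily_iff_of_partialConj (forall_exists_partialConj_of_conj_apply_eq hreal) Φ

omit [Nonempty I] in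
/-- **Conversely, nondegeneracy of the family needs no hypothesis to descend to the members**, but the rank defect of
the family is at least that of each member admitting a partial conjugation: `cmTypeRank Φ_i − 1 ≤ cmFamilyRank Φ − 1`
(`rank Hg(A_i) ≤ rank Hg(∏_j A_j)`, "`Hg(A)` surjects onto each factor"). [cite: Gordon1999HodgeAVSurvey, §3 Theorem (proof)] -/
theorem cmTypeRank_le_cmFamilyRank_of_partialConj {i : I} {σ : ℂ ≃+* ℂ}
    (hσ : ∀ s : K i →+* ℂ, σ • s = (starRingAut : ℂ ≃+* ℂ) • s) (hσ' : ∀ j, j ≠ i → ∀ s : K j →+* ℂ, σ • s = s)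
    (Φ : ∀ i, CMType (K i)) : cmTypeRank (Φ i) ≤ CMAlgebra.cmFamilyRank Φ := by
  haveI : Nonempty ((i : I) × (K i →+* ℂ)) := ⟨⟨i, Classical.arbitrary _⟩⟩
  have h : Module.finrank ℚ (antiSpan (ℂ ≃+* ℂ) (Φ i).1) ≤
      Module.finrank ℚ (antiSpan (ℂ ≃+* ℂ) (sigmaType fun i => (Φ i).1)) :=
    finrank_antiSpan_le_of_partialConj (G := ℂ ≃+* ℂ) (Φ := fun i => (Φ i).1)
      (fun i => isCMTypeWith_conj (Φ i)) hσ hσ'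
  have h1 : typeRank (ℂ ≃+* ℂ) (Φ i).1 = Module.finrank ℚ (antiSpan (ℂ ≃+* ℂ) (Φ i).1) + 1 :=
    (isCMTypeWith_conj (Φ i)).typeRank_eq_finrank_antiSpan_add_one
  have h2 : typeRank (ℂ ≃+* ℂ) (sigmaType fun i => (Φ i).1) =
      Module.finrank ℚ (antiSpan (ℂ ≃+* ℂ) (sigmaType fun i => (Φ i).1)) + 1 :=
    (IsCMTypeWith.sigmaType fun i => isCMTypeWith_conj (Φ i)).typeRank_eq_finrank_antiSpan_add_one
  change typeRank (ℂ ≃+* ℂ) (Φ i).1 ≤ typeRank (ℂ ≃+* ℂ) (sigmaType fun i => (Φ i).1)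
  omega

end Rank

/-! ### Hodge classes on products of CM abelian varieties whose Galois closures meet in totally real fields -/

section Geometry

variable {I : Type} {K : I → Type} [∀ i, Field (K i)] [∀ i, NumberField (K i)] [∀ i, IsCMField (K i)] [Fintype I]
  [Nonempty I] {Φ : ∀ i, CMType (K i)}
variable {A : I → AbelianVariety ℂ} {ι : ∀ i, 𝓞 (K i) →+* End (A i)}
  {θ : ∀ i, K i →+* Module.End ℂ (complexBetti (A i).X 1)}

/-- **`Bᵐ ⊗ ℂ = Dᵐ ⊗ ℂ` on every product `⨁_{j<N} A_{π j}` (every `∏_i A_i^{k_i}`) of realisations of nondegenerate CM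
types of CM fields admitting partial conjugations** — such products are stably nondegenerate (Gordon §3 Theorem (2)
"`Hdg(A) = … = Div(A)`" beyond elliptic curves). [cite: Gordon1999HodgeAVSurvey, §3 Theorem (2) and 7.5] -/
theorem hodgeClassSpan_prod_eq_divisorClassesSpan_of_partialConj
    (hconj : ∀ i : I, ∃ σ : ℂ ≃+* ℂ, (∀ s : K i →+* ℂ, σ • s = (starRingAut : ℂ ≃+* ℂ) • s) ∧
      ∀ j, j ≠ i → ∀ s : K j →+* ℂ, σ • s = s)
    (hΦ : ∀ i, IsNondegenerate (Φ i)) (hA : ∀ i, IsCMTypeRealisation (Φ i) (A i) (ι i) (θ i)) {N : ℕ}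
    (π : Fin N → I) (m : ℕ) :
    hodgeClassSpan (⨁ fun j : Fin N => A (π j)).dim (⨁ fun j : Fin N => A (π j)).X m =
      divisorClassesSpan (⨁ fun j : Fin N => A (π j)).X (⨁ fun j : Fin N => A (π j)).dim m :=
  ((isNondegenerateFamily_iff_of_partialConj hconj Φ).2 hΦ).hodgeClassSpan_prod_eq_divisorClassesSpan hA π m

/-- **The Hodge conjecture for every product `⨁_{j<N} A_{π j}` (every `∏_i A_i^{k_i}`) of realisations of NONDEGENERATE CM
types `(K_i; Φ_i)` of CM fields admitting PARTIAL CONJUGATIONS** (for every `i` some `σ_i ∈ Aut(ℂ)` is conjugation on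
`Hom(K_i, ℂ)` and trivial on the other `Hom(K_j, ℂ)`), UNCONDITIONAL (no named fact): the product is stably nondegenerate,
so every Hodge class on it is a polynomial in divisor classes (Lefschetz (1,1)). [cite: Gordon1999HodgeAVSurvey, §3 Theorem and 10.10] -/
theorem hodgeConjectureFor_prod_of_partialConj
    (hconj : ∀ i : I, ∃ σ : ℂ ≃+* ℂ, (∀ s : K i →+* ℂ, σ • s = (starRingAut : ℂ ≃+* ℂ) • s) ∧
      ∀ j, j ≠ i → ∀ s : K j →+* ℂ, σ • s = s)
    (hΦ : ∀ i, IsNondegenerate (Φ i)) (hA : ∀ i, IsCMTypeRealisation (Φ i) (A i) (ι i) (θ i)) {N : ℕ}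
    (π : Fin N → I) :
    HodgeConjectureFor (⨁ fun j : Fin N => A (π j)).dim (⨁ fun j : Fin N => A (π j)).X :=
  ((isNondegenerateFamily_iff_of_partialConj hconj Φ).2 hΦ).hodgeConjectureFor_prod hA π

/-- **`Bᵐ ⊗ ℂ = Dᵐ ⊗ ℂ` on every product `⨁_{j<N} A_{π j}` of realisations of nondegenerate CM types of CM fields whose
Galois closures meet in totally real fields.** [cite: Gordon1999HodgeAVSurvey, §3 Theorem (2) and 7.5] -/
theorem hodgeClassSpan_prod_eq_divisorClassesSpan_of_conj_apply_eq
    (hreal : ∀ (i : I) (x : ℂ), x ∈ normalClosure ℚ (K i) ℂ →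
      x ∈ (⨆ j : {j : I // j ≠ i}, normalClosure ℚ (K j.1) ℂ) → starRingEnd ℂ x = x)
    (hΦ : ∀ i, IsNondegenerate (Φ i)) (hA : ∀ i, IsCMTypeRealisation (Φ i) (A i) (ι i) (θ i)) {N : ℕ}
    (π : Fin N → I) (m : ℕ) :
    hodgeClassSpan (⨁ fun j : Fin N => A (π j)).dim (⨁ fun j : Fin N => A (π j)).X m =
      divisorClassesSpan (⨁ fun j : Fin N => A (π j)).X (⨁ fun j : Fin N => A (π j)).dim m :=
  hodgeClassSpan_prod_eq_divisorClassesSpan_of_partialConj (forall_exists_partialConj_of_conj_apply_eq hreal) hΦ hA π m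

/-- **No product `⨁_{j<N} A_{π j}` of realisations of nondegenerate CM types of CM fields whose Galois closures meet in
totally real fields supports an exotic Hodge class.** [cite: Gordon1999HodgeAVSurvey, §3 Theorem (2) and 7.5] -/
theorem not_exists_exceptional_prod_of_conj_apply_eq
    (hreal : ∀ (i : I) (x : ℂ), x ∈ normalClosure ℚ (K i) ℂ →
      x ∈ (⨆ j : {j : I // j ≠ i}, normalClosure ℚ (K j.1) ℂ) → starRingEnd ℂ x = x)
    (hΦ : ∀ i, IsNondegenerate (Φ i)) (hA : ∀ i, IsCMTypeRealisation (Φ i) (A i) (ι i) (θ i)) {N : ℕ}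
    (π : Fin N → I) (m : ℕ) :
    ¬∃ c : complexBetti (⨁ fun j : Fin N => A (π j)).X (2 * m), IsRationalClass c ∧
        IsOfHodgeType (⨁ fun j : Fin N => A (π j)).dim (⨁ fun j : Fin N => A (π j)).X (2 * m) m m c ∧
        c ∉ divisorClassesSpan (⨁ fun j : Fin N => A (π j)).X (⨁ fun j : Fin N => A (π j)).dim m :=
  ((isNondegenerateFamily_iff_of_partialConj (forall_exists_partialConj_of_conj_apply_eq hreal) Φ).2
    hΦ).not_exists_exceptional_prod hA π m

/-- **The Hodge conjecture for every product `⨁_{j<N} A_{π j}` (every `∏_i A_i^{k_i}`) of realisations of NONDEGENERATE CM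
types `(K_i; Φ_i)` of CM fields whose Galois closures MEET IN TOTALLY REAL FIELDS** — complex conjugation fixing
`L_i ∩ ∏_{j≠i} L_j` pointwise for every `i` — UNCONDITIONAL (no named fact).  This contains the linearly disjoint case
(`LinearlyDisjointCMFieldsHodge`: `L_i ∩ ∏_{j≠i} L_j = ℚ`) and reaches products whose fields share a totally real subfield,
e.g. two distinct cyclic quartic CM fields over the same `ℚ(√d)`, or `ℚ(ζ_7)` with `ℚ(ζ_7)⁺(√−3)`.
[cite: Gordon1999HodgeAVSurvey, §3 Theorem and 10.10] -/
theorem hodgeConjectureFor_prod_of_conj_apply_eq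
    (hreal : ∀ (i : I) (x : ℂ), x ∈ normalClosure ℚ (K i) ℂ →
      x ∈ (⨆ j : {j : I // j ≠ i}, normalClosure ℚ (K j.1) ℂ) → starRingEnd ℂ x = x)
    (hΦ : ∀ i, IsNondegenerate (Φ i)) (hA : ∀ i, IsCMTypeRealisation (Φ i) (A i) (ι i) (θ i)) {N : ℕ}
    (π : Fin N → I) :
    HodgeConjectureFor (⨁ fun j : Fin N => A (π j)).dim (⨁ fun j : Fin N => A (π j)).X :=
  hodgeConjectureFor_prod_of_partialConj (forall_exists_partialConj_of_conj_apply_eq hreal) hΦ hA π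

/-! ### Usable criteria: odd degree, one real field, two slots -/

/-- **The Hodge conjecture for every `∏_i A_i^{k_i}` of realisations of nondegenerate CM types whose Galois closures meet
the compositum of the others in fields of ODD degree** (odd-degree Galois subfields of `ℂ` are totally real) — e.g.
`ℚ(ζ_7)` and `ℚ(ζ_7)⁺(√−3)` (intersection the real cubic field), or `F·k_i` for a totally real Galois `F` of odd degree and
distinct imaginary quadratic `k_i` outside the compositum of the others. [cite: Gordon1999HodgeAVSurvey, §3 Theorem and 10.10] -/
theorem hodgeConjectureFor_prod_of_odd_finrank_inf
    (hodd : ∀ i : I, Odd (Module.finrank ℚ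
      ↥(normalClosure ℚ (K i) ℂ ⊓ ⨆ j : {j : I // j ≠ i}, normalClosure ℚ (K j.1) ℂ)))
    (hΦ : ∀ i, IsNondegenerate (Φ i)) (hA : ∀ i, IsCMTypeRealisation (Φ i) (A i) (ι i) (θ i)) {N : ℕ}
    (π : Fin N → I) :
    HodgeConjectureFor (⨁ fun j : Fin N => A (π j)).dim (⨁ fun j : Fin N => A (π j)).X :=
  hodgeConjectureFor_prod_of_partialConj (forall_exists_partialConj_of_odd_finrank_inf hodd) hΦ hA π

/-- **The Hodge conjecture for every `∏_i A_i^{k_i}` of realisations of nondegenerate CM types whose Galois closures meet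
the compositum of the others inside ONE real field `F ≤ ℂ`** (`F` fixed pointwise by conjugation; e.g. `F = ℚ(√5)` for
two distinct cyclic quartic CM fields over `ℚ(√5)`). [cite: Gordon1999HodgeAVSurvey, §3 Theorem and 10.10] -/
theorem hodgeConjectureFor_prod_of_inf_le (F : IntermediateField ℚ ℂ) (hF : ∀ x : ℂ, x ∈ F → starRingEnd ℂ x = x)
    (hle : ∀ i : I, normalClosure ℚ (K i) ℂ ⊓ (⨆ j : {j : I // j ≠ i}, normalClosure ℚ (K j.1) ℂ) ≤ F)
    (hΦ : ∀ i, IsNondegenerate (Φ i)) (hA : ∀ i, IsCMTypeRealisation (Φ i) (A i) (ι i) (θ i)) {N : ℕ}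
    (π : Fin N → I) :
    HodgeConjectureFor (⨁ fun j : Fin N => A (π j)).dim (⨁ fun j : Fin N => A (π j)).X :=
  hodgeConjectureFor_prod_of_partialConj (forall_exists_partialConj_of_inf_le F hF hle) hΦ hA π

/-- **Two slots**: for `K_{i₀}`, `K_{i₁}` with complex conjugation fixing `L_{i₀} ∩ L_{i₁}` pointwise and nondegenerate
types, every `A_{i₀}^a × A_{i₁}^b` (every `⨁_{j<N} A_{π j}`) of realisations satisfies the Hodge conjecture and
`B• = D•`; the family is nondegenerate iff both types are. [cite: Gordon1999HodgeAVSurvey, §3 Theorem and 10.10] -/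
theorem hodgeConjectureFor_prod_pair_of_conj_apply_eq {i₀ i₁ : I} (h01 : i₀ ≠ i₁) (hI : ∀ j, j = i₀ ∨ j = i₁)
    (hreal : ∀ x : ℂ, x ∈ normalClosure ℚ (K i₀) ℂ → x ∈ normalClosure ℚ (K i₁) ℂ → starRingEnd ℂ x = x)
    (hΦ : ∀ i, IsNondegenerate (Φ i)) (hA : ∀ i, IsCMTypeRealisation (Φ i) (A i) (ι i) (θ i)) {N : ℕ}
    (π : Fin N → I) :
    HodgeConjectureFor (⨁ fun j : Fin N => A (π j)).dim (⨁ fun j : Fin N => A (π j)).X :=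
  hodgeConjectureFor_prod_of_partialConj (forall_exists_partialConj_pair h01 hI hreal) hΦ hA π

/-- Two slots: the family `(Φ_{i₀}, Φ_{i₁})` is nondegenerate iff both members are, as soon as complex conjugation fixes
`L_{i₀} ∩ L_{i₁}` pointwise. [cite: Gordon1999HodgeAVSurvey, §3 Theorem and 7.5] -/
theorem isNondegenerateFamily_iff_pair_of_conj_apply_eq {i₀ i₁ : I} (h01 : i₀ ≠ i₁) (hI : ∀ j, j = i₀ ∨ j = i₁)
    (hreal : ∀ x : ℂ, x ∈ normalClosure ℚ (K i₀) ℂ → x ∈ normalClosure ℚ (K i₁) ℂ → starRingEnd ℂ x = x) :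
    CMAlgebra.IsNondegenerateFamily Φ ↔ ∀ i, IsNondegenerate (Φ i) :=
  isNondegenerateFamily_iff_of_partialConj (forall_exists_partialConj_pair h01 hI hreal) Φ

/-- **Two slots, odd degree**: if `L_{i₀} ∩ L_{i₁}` has ODD degree over `ℚ` (so is totally real), every `A_{i₀}^a × A_{i₁}^b`
of realisations of nondegenerate types satisfies the Hodge conjecture — e.g. a `ℚ(ζ_7)`-threefold of primitive type times a
`ℚ(ζ_7)⁺(√−3)`-threefold of primitive type, to any powers (intersection `ℚ(ζ_7)⁺`, degree `3`).
[cite: Gordon1999HodgeAVSurvey, §3 Theorem and 10.10] -/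
theorem hodgeConjectureFor_prod_pair_of_odd_finrank {i₀ i₁ : I} (h01 : i₀ ≠ i₁) (hI : ∀ j, j = i₀ ∨ j = i₁)
    (hodd : Odd (Module.finrank ℚ ↥(normalClosure ℚ (K i₀) ℂ ⊓ normalClosure ℚ (K i₁) ℂ)))
    (hΦ : ∀ i, IsNondegenerate (Φ i)) (hA : ∀ i, IsCMTypeRealisation (Φ i) (A i) (ι i) (θ i)) {N : ℕ}
    (π : Fin N → I) :
    HodgeConjectureFor (⨁ fun j : Fin N => A (π j)).dim (⨁ fun j : Fin N => A (π j)).X :=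
  hodgeConjectureFor_prod_of_partialConj (forall_exists_partialConj_pair_of_odd_finrank h01 hI hodd) hΦ hA π

end Geometry

end Summit.HodgeConjecture.CorCM

end
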